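import Summits.QuantumFields.BalabanUV.Beta.EriceFlowEnclosureB12AsPrintedHistoryContagionShiftFlow
import Summits.QuantumFields.BalabanUV.Beta.EriceFlowEnclosureB12AsPrintedHistoryContagionShiftPin

/-!
# Beta / EriceFlowEnclosureB12AsPrintedHistoryContagionShiftFlowEnd — ASYMPTOTIC FREEDOM IS CONTAGIOUS, part 11 (the intrinsic END): on the as-printed carrier,
# [I] THEOREM 2 AS TYPED + the binder `hrg` + NE4 + coupling-chart fading memory (θ < 1) on a box of ANY size ⟹ for every torus exponent m there is g₇ > 0 such
# that at EVERY renormalized coupling g ∈ ]0, g₇] the RENORMALIZATION GROUP EQUATION OF THE LIMIT THEORY — node U2's flow with memory of the STATIONARY functional,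
# `h(0) = g`, `1∕h(m′+1)² = 1∕h(m′)² + betaInf S.β (h(m′+1), h(m′+2), …)` — has EXACTLY ONE box-valued solution, namely the continuum running coupling of Theorem 2's
# tuned rows «g₀(ε, g)» (part 6): THE CONTINUUM RUNNING COUPLING IS CHARACTERISED INTRINSICALLY, with no reference to the approximating lattice families, and with
# NO asymptotic-freedom letter, NO sign, NO `C_m γ < b(1−θ)` — node U2's `T4BetaFlowWellPosed.eq_gstar_of_memFlow` floor-free near zero (β-flow team, prover 1,
# unit `b2b-balaban-beta-bflow-p1`, gen 36; ROW AP-I·Uc × NODE U2; part 10 `…HistoryContagionShiftFlow` = the abstract continuum contagion)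

HONEST FRAMING (page 1 of everything the β sub-cell writes): discharging `BetaPertH` makes Bałaban's UV stability UNCONDITIONAL — a
real constructive-QFT result; it is NOT the continuum limit and NOT the Clay problem.  HONEST DEPENDENCY (cell reorg 2026-08-19,
verbatim): «continuum YM on T⁴ ⇐ BetaPertH ∧ nine spine estimates (0/9 proved); BetaPertH ⇐ (D1) ∧ (D4) ∧ CAP+tail; G-an2-4 gates
asym, D1 and NE2/3/4.»  THIS MODULE DISCHARGES NOTHING: a junction BY NAME of part 10 (`memFlow_unique_of_reference`) with part 6 (`continuumCoupling_bigBox_of_typedTheorem2`,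
`memFlow_bigBox_of_typedTheorem2`, `continuumCoupling_of_typedTheorem2`) and node U2's `T4BetaStationary.memoryProfile_betaInf` ∕ `T4ContinuumCoupling.one_div_gstar_sq`, over
the NAMED FIELDS of `B12BetaAsPrinted` ([I] = T. Bałaban, Commun. Math. Phys. **109** (1987) [Balaban1987RG1]): `Theorem2Statement S hL` (Theorem 2 AS TYPED — STATED
WITHOUT PROOF in print, p. 259; a HYPOTHESIS), the binder `hrg` ((0.20) along in-box rows).  The LETTERS `ScaleShiftRate` (NE4; NOT PRINTED, GAPS G-t4-U2-1) and
`HistLipschitz` ∕ `FadingMemory` (NOT PRINTED, GAPS G-t4-U2-2) are hypotheses on the abstract family `S.β`; NOTHING is asserted about Bałaban's β.  «Continuum running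
coupling» = the K → ∞ limit of the effective couplings of (0.20) at fixed physical scale (`T4ContinuumCoupling.gstar`), NOT the continuum limit of the measures.

WHAT THIS FILE PROVES (0 sorry, 0 def): `flow_threshold_exists` (the pin threshold), **`memFlow_existsUnique_of_typedTheorem2`** (∀ m ∃ g₇ > 0 ∀ g ∈ ]0, g₇]: a box solution of
`MemFlow (betaInf S.β) g ·` EXISTS — the continuum running coupling of Theorem 2's rows at g — and ANY two box solutions COINCIDE), **`eq_gstar_of_memFlow_typed`** (every box
solution at such a g IS the continuum running coupling of Theorem 2's tuned row family at g), **`memFlow_biLipschitz_of_typedTheorem2`** (the unique box solutions at pins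
g ≤ g′ ≤ g₈ satisfy part 9's law `(2∕3)(1∕g² − 1∕g′²) ≤ 1∕h(m′)² − 1∕h′(m′)² ≤ (4∕3)(1∕g² − 1∕g′²)` and `h < h′` if g < g′: the solution of the limit RG equation depends
STRICTLY MONOTONICALLY and BI-LIPSCHITZ-LY on its renormalized coupling).  (Imports part 9 `…HistoryContagionShiftPin` for the last item.)
NOT CLAIMED: anything about Bałaban's β; Theorem 2; `BetaPertH`; the continuum limit of the measures; Clay.
-/

namespace Summit.QuantumFields.BalabanUV.Beta.EriceFlowEnclosureB12AsPrintedHistoryContagionShiftFlowEnd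

open Finset Filter Topology
open Literature.MathematicalPhysics.QuantumFieldTheory.Balaban1983to89
open Literature.MathematicalPhysics.QuantumFieldTheory.Balaban1983to89.B12BetaAsPrinted
open Literature.MathematicalPhysics.QuantumFieldTheory.Balaban1983to89.FlowStep (RGEqH)
open Literature.MathematicalPhysics.QuantumFieldTheory.Balaban1983to89.T4CouplingMatching (HistLipschitz FadingMemory ScaleShiftRate disc)
open Literature.MathematicalPhysics.QuantumFieldTheory.Balaban1983to89.T4CauchySum (InjectedRate)
open Literature.MathematicalPhysics.QuantumFieldTheory.Balaban1983to89.T4ContinuumCoupling (astar gstar)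
open Literature.MathematicalPhysics.QuantumFieldTheory.Balaban1983to89.T4BetaStationary (SeqBox betaInf memoryProfile_betaInf)
open Literature.MathematicalPhysics.QuantumFieldTheory.Balaban1983to89.T4BetaFlowWellPosed (MemFlow)
open Summit.QuantumFields.BalabanUV.Beta.EriceFlowEnclosureB12AsPrintedHistoryContagionShiftEnd (continuumCoupling_bigBox_of_typedTheorem2
  memFlow_bigBox_of_typedTheorem2 continuumCoupling_of_typedTheorem2)
open Summit.QuantumFields.BalabanUV.Beta.EriceFlowEnclosureB12AsPrintedHistoryContagionShiftFlow (memFlow_unique_of_reference)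
open Summit.QuantumFields.BalabanUV.Beta.EriceFlowEnclosureB12AsPrintedHistoryContagionShiftPin (astar_biLipschitz_of_typedTheorem2)

noncomputable section

variable {S : Setting}

/-- THE PIN THRESHOLD of part 10's intrinsic uniqueness: for C ≥ 0, θ < 1, b > 0 and any Q there is e₀ > 0 with `4Ce ≤ b(1−θ)`, `e²·Q ≤ 3∕4`, `64Ce³ ≤ (1−θ)²` for all
e ∈ ]0, e₀]. [folklore] -/
theorem flow_threshold_exists {C θ b : ℝ} (Q : ℝ) (hC : 0 ≤ C) (hθ1 : θ < 1) (hb : 0 < b) :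
    ∃ e₀ : ℝ, 0 < e₀ ∧ ∀ e : ℝ, 0 < e → e ≤ e₀ → 4 * C * e ≤ b * (1 - θ) ∧ e ^ 2 * Q ≤ 3 / 4 ∧ 64 * C * e ^ 3 ≤ (1 - θ) ^ 2 := by
  have h1θ : 0 < 1 - θ := by linarith
  refine ⟨min 1 (min (b * (1 - θ) / (4 * C + 1)) (min (3 / (4 * (|Q| + 1))) ((1 - θ) ^ 2 / (64 * C + 1)))),
    lt_min one_pos (lt_min (by positivity) (lt_min (by positivity) (by positivity))), fun e he hle => ?_⟩
  have h1 : e ≤ 1 := hle.trans (min_le_left _ _)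
  have h2 : e ≤ b * (1 - θ) / (4 * C + 1) := hle.trans ((min_le_right _ _).trans (min_le_left _ _))
  have h3 : e ≤ 3 / (4 * (|Q| + 1)) := hle.trans ((min_le_right _ _).trans ((min_le_right _ _).trans (min_le_left _ _)))
  have h4 : e ≤ (1 - θ) ^ 2 / (64 * C + 1) := hle.trans ((min_le_right _ _).trans ((min_le_right _ _).trans (min_le_right _ _)))
  refine ⟨?_, ?_, ?_⟩
  · rw [le_div_iff₀ (by positivity)] at h2; nlinarith
  · rw [le_div_iff₀ (by positivity)] at h3
    have he2 : e ^ 2 ≤ e := by nlinarith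
    nlinarith [mul_le_mul_of_nonneg_left (le_abs_self Q) (sq_nonneg e), abs_nonneg Q, mul_nonneg he.le (abs_nonneg Q)]
  · rw [le_div_iff₀ (by positivity)] at h4
    have he3 : e ^ 3 ≤ e := by
      have he21 : e ^ 2 ≤ 1 := by nlinarith
      calc e ^ 3 = e * e ^ 2 := by ring
        _ ≤ e * 1 := mul_le_mul_of_nonneg_left he21 he.le
        _ = e := mul_one e
    nlinarith [mul_le_mul_of_nonneg_left he3 (by positivity : (0 : ℝ) ≤ 64 * C)]

/-- **THE RENORMALIZATION GROUP EQUATION OF THE LIMIT HAS EXACTLY ONE BOX SOLUTION AT EVERY SMALL RENORMALIZED COUPLING — FROM THEOREM 2 AS TYPED.**  `Theorem2Statement S hL`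
(a HYPOTHESIS), the binder `hrg` on ]0, γ_u], NE4 `ScaleShiftRate c θ γ_u S.β` (c ≥ 0), `HistLipschitz Λ γ_u S.β` with `FadingMemory C θ Λ` (0 < θ < 1, C ≥ 0; γ_u ARBITRARY against
(C, θ)) ⟹ for every torus exponent m there is g₇ > 0 such that for EVERY g ∈ ]0, g₇]: (i) SOME box-valued h : ℕ → ]0, γ_u] solves node U2's flow with memory of the stationary
functional, `MemFlow (betaInf S.β) g h` — namely the continuum running coupling of Theorem 2's tuned row family at g (part 6); (ii) ANY two box-valued solutions with pin g
COINCIDE (part 10's floor-free contraction, the reference being the continuum running coupling of Theorem 2's rows at ONE fixed coupling g_r, its memory profile node U2's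
`memoryProfile_betaInf`).  Node U2's `existsUnique_memFlow` ∕ `eq_gstar_of_memFlow` had this from the AF floor `EventualLowerH b` + `C_m γ < b(1 − θ)`; here NEITHER is assumed.
[cite: Balaban1987RG1, Thm 2 (0.31) p.259 with (0.20) p.256 and §5 p.298] -/
theorem memFlow_existsUnique_of_typedTheorem2 {hL : Odd S.L ∧ 1 < S.L} (h : Theorem2Statement S hL)
    {γu θ C c : ℝ} {Λ : ℕ → ℕ → ℝ} (hγu : 0 < γu)
    (hrg : ∀ P : B12.RunParams, Step.InInterval γu P.K (S.cpl P) → RGEqH P.K S.β (S.cpl P))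
    (hS : ScaleShiftRate c θ γu S.β) (hL' : HistLipschitz Λ γu S.β) (hΛ : FadingMemory C θ Λ)
    (hθ0 : 0 < θ) (hθ1 : θ < 1) (hC : 0 ≤ C) (hc : 0 ≤ c) (m : ℕ) :
    ∃ g₇ : ℝ, 0 < g₇ ∧ ∀ e : ℝ, 0 < e → e ≤ g₇ →
      (∃ g₀ : ℕ → ℝ, (∀ K, Step.InInterval γu K (S.cpl ⟨K, m, g₀ K⟩)) ∧ (∀ K, S.cpl ⟨K, m, g₀ K⟩ K = e) ∧
        SeqBox γu (gstar (fun K => S.cpl ⟨K, m, g₀ K⟩)) ∧ MemFlow (betaInf S.β) e (gstar (fun K => S.cpl ⟨K, m, g₀ K⟩))) ∧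
      (∀ h₁ h₂ : ℕ → ℝ, SeqBox γu h₁ → SeqBox γu h₂ → MemFlow (betaInf S.β) e h₁ → MemFlow (betaInf S.β) e h₂ → h₁ = h₂) := by
  have h1θ : 0 < 1 - θ := by linarith
  have hB := memoryProfile_betaInf hS hL' hΛ hθ0.le hθ1
  -- part 6: thresholds for MemFlow of pinned row families, the two-sided profile, and existence of Theorem 2's rows
  obtain ⟨g₂, hg₂, hmem⟩ := memFlow_bigBox_of_typedTheorem2 h hγu hrg hS hL' hΛ hθ0 hθ1 hC hc m
  obtain ⟨g₂', b, b', hg₂', hb, -, hall⟩ := continuumCoupling_bigBox_of_typedTheorem2 h hγu hrg hS hL' hΛ hθ0 hθ1 hC hc m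
  obtain ⟨g₃, b₃, b₃', hg₃, -, -, hex⟩ := continuumCoupling_of_typedTheorem2 h hγu hrg hS hL' hΛ hθ0 hθ1 hC hc m
  -- the reference: Theorem 2's row family at the fixed coupling g_r and its continuum running coupling
  set gr : ℝ := min g₃ (min g₂ g₂') with hgr
  have hgr0 : 0 < gr := lt_min hg₃ (lt_min hg₂ hg₂')
  obtain ⟨g₀r, hIr, hendr, -⟩ := hex gr hgr0 (min_le_left _ _)
  have hrowr : ∀ K, ∃ (m' : ℕ) (g₀ : ℝ), (fun K => S.cpl ⟨K, m, g₀r K⟩) K = S.cpl ⟨K, m', g₀⟩ := fun K => ⟨m, g₀r K, rfl⟩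
  obtain ⟨-, htbox, htflow⟩ := hmem (fun K => S.cpl ⟨K, m, g₀r K⟩) gr hrowr hIr hendr ((min_le_right _ _).trans (min_le_left _ _))
  obtain ⟨hinjr, -, -, -, -, -, -, hprofr, -⟩ :=
    hall (fun K => S.cpl ⟨K, m, g₀r K⟩) gr hrowr hIr hendr ((min_le_right _ _).trans (min_le_right _ _))
  have hboxr : ∀ K i, i ≤ K → 0 < S.cpl ⟨K, m, g₀r K⟩ i ∧ S.cpl ⟨K, m, g₀r K⟩ i ≤ γu := fun K => hIr K
  have hprof : ∀ m' : ℕ, 1 / (2 * gr) ^ 2 + b * (m' : ℝ) ≤ 1 / (gstar (fun K => S.cpl ⟨K, m, g₀r K⟩) m') ^ 2 := by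
    intro m'
    rw [T4ContinuumCoupling.one_div_gstar_sq hθ1 hinjr hboxr m']
    have e1 : 1 / (2 * gr) ^ 2 = 1 / (4 * gr ^ 2) := by ring
    rw [e1]
    exact (hprofr m').1
  -- the pin threshold
  obtain ⟨e₀, he₀, hthr⟩ := flow_threshold_exists (1 / gr ^ 2 + C * γu / (1 - θ) ^ 2 + (2 * C / ((1 - θ) * b)) ^ 2) hC hθ1 hb
  refine ⟨min e₀ (min g₂ g₃), lt_min he₀ (lt_min hg₂ hg₃), fun e he hle => ⟨?_, ?_⟩⟩
  · -- existence: Theorem 2's own rows at e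
    obtain ⟨g₀, hI, hend, -⟩ := hex e he (hle.trans ((min_le_right _ _).trans (min_le_right _ _)))
    obtain ⟨-, hbox, hflow⟩ := hmem (fun K => S.cpl ⟨K, m, g₀ K⟩) e (fun K => ⟨m, g₀ K, rfl⟩) hI hend
      (hle.trans ((min_le_right _ _).trans (min_le_left _ _)))
    exact ⟨g₀, hI, hend, hbox, hflow⟩
  · -- uniqueness: part 10
    intro h₁ h₂ hh₁ hh₂ hf₁ hf₂
    obtain ⟨hs1, hs2, hs4⟩ := hthr e he (hle.trans (min_le_left _ _))
    exact memFlow_unique_of_reference hB hC hθ0.le hθ1 hb (by positivity : (0 : ℝ) < 2 * gr) htbox htflow hprof hh₁ hf₁ hh₂ hf₂ hs1 hs2 hs4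

/-- **EVERY BOX SOLUTION IS THE CONTINUUM RUNNING COUPLING OF THEOREM 2's ROWS (intrinsic characterisation).**  Under the data of `memFlow_existsUnique_of_typedTheorem2`, for every
m there is g₇ > 0 such that for every g ∈ ]0, g₇], every family of Theorem-2-type rows (K, m, g₀ K) in ]0, γ_u] pinned at g (so, by part 6, with a continuum running coupling
`gstar`) and EVERY box-valued solution h of `MemFlow (betaInf S.β) g h`: **`h = gstar (K ↦ g_{K,·})`** — node U2's `eq_gstar_of_memFlow` with its asymptotic-freedom floor and its
admission `C_m γ < b(1 − θ)` replaced by Theorem 2 AS TYPED at one endpoint and smallness of g. [cite: Balaban1987RG1, Thm 2 (0.31) p.259 with (0.20) p.256 and §5 p.298] -/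
theorem eq_gstar_of_memFlow_typed {hL : Odd S.L ∧ 1 < S.L} (h : Theorem2Statement S hL)
    {γu θ C c : ℝ} {Λ : ℕ → ℕ → ℝ} (hγu : 0 < γu)
    (hrg : ∀ P : B12.RunParams, Step.InInterval γu P.K (S.cpl P) → RGEqH P.K S.β (S.cpl P))
    (hS : ScaleShiftRate c θ γu S.β) (hL' : HistLipschitz Λ γu S.β) (hΛ : FadingMemory C θ Λ)
    (hθ0 : 0 < θ) (hθ1 : θ < 1) (hC : 0 ≤ C) (hc : 0 ≤ c) (m : ℕ) :
    ∃ g₇ : ℝ, 0 < g₇ ∧ ∀ (e : ℝ) (g₀ : ℕ → ℝ) (h' : ℕ → ℝ), 0 < e → e ≤ g₇ →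
      (∀ K, Step.InInterval γu K (S.cpl ⟨K, m, g₀ K⟩)) → (∀ K, S.cpl ⟨K, m, g₀ K⟩ K = e) →
      SeqBox γu h' → MemFlow (betaInf S.β) e h' → h' = gstar (fun K => S.cpl ⟨K, m, g₀ K⟩) := by
  obtain ⟨g₇, hg₇, hmain⟩ := memFlow_existsUnique_of_typedTheorem2 h hγu hrg hS hL' hΛ hθ0 hθ1 hC hc m
  obtain ⟨g₂, hg₂, hmem⟩ := memFlow_bigBox_of_typedTheorem2 h hγu hrg hS hL' hΛ hθ0 hθ1 hC hc m
  refine ⟨min g₇ g₂, lt_min hg₇ hg₂, fun e g₀ h' he hle hI hend hh' hf' => ?_⟩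
  obtain ⟨-, huniq⟩ := hmain e he (hle.trans (min_le_left _ _))
  obtain ⟨-, hbox, hflow⟩ := hmem (fun K => S.cpl ⟨K, m, g₀ K⟩) e (fun K => ⟨m, g₀ K, rfl⟩) hI hend (hle.trans (min_le_right _ _))
  exact huniq h' _ hh' hbox hf' hflow

/-- **THE UNIQUE SOLUTION OF THE LIMIT RG EQUATION DEPENDS STRICTLY MONOTONICALLY AND BI-LIPSCHITZ-LY ON THE RENORMALIZED COUPLING.**  Under the data of
`memFlow_existsUnique_of_typedTheorem2`, for every m there is g₈ > 0 such that two box-valued solutions h, h′ of `MemFlow (betaInf S.β) g h`, `MemFlow (betaInf S.β) g′ h′`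
with 0 < g ≤ g′ ≤ g₈ satisfy at EVERY physical scale m′: `(2∕3)(1∕g² − 1∕g′²) ≤ 1∕h(m′)² − 1∕h′(m′)² ≤ (4∕3)(1∕g² − 1∕g′²)`, and `h(m′) < h′(m′)` whenever g < g′ —
`eq_gstar_of_memFlow_typed` (both are continuum running couplings of Theorem 2's rows) + part 9's `astar_biLipschitz_of_typedTheorem2`.
[cite: Balaban1987RG1, Thm 2 (0.31) p.259 with (0.20) p.256 and §5 p.298] -/
theorem memFlow_biLipschitz_of_typedTheorem2 {hL : Odd S.L ∧ 1 < S.L} (h : Theorem2Statement S hL)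
    {γu θ C c : ℝ} {Λ : ℕ → ℕ → ℝ} (hγu : 0 < γu)
    (hrg : ∀ P : B12.RunParams, Step.InInterval γu P.K (S.cpl P) → RGEqH P.K S.β (S.cpl P))
    (hS : ScaleShiftRate c θ γu S.β) (hL' : HistLipschitz Λ γu S.β) (hΛ : FadingMemory C θ Λ)
    (hθ0 : 0 < θ) (hθ1 : θ < 1) (hC : 0 ≤ C) (hc : 0 ≤ c) (m : ℕ) :
    ∃ g₈ : ℝ, 0 < g₈ ∧ ∀ (e e' : ℝ) (h₁ h₂ : ℕ → ℝ), 0 < e → e ≤ e' → e' ≤ g₈ →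
      SeqBox γu h₁ → SeqBox γu h₂ → MemFlow (betaInf S.β) e h₁ → MemFlow (betaInf S.β) e' h₂ →
      (∀ m', 2 / 3 * (1 / e ^ 2 - 1 / e' ^ 2) ≤ 1 / (h₁ m') ^ 2 - 1 / (h₂ m') ^ 2 ∧
        1 / (h₁ m') ^ 2 - 1 / (h₂ m') ^ 2 ≤ 4 / 3 * (1 / e ^ 2 - 1 / e' ^ 2)) ∧
      (e < e' → ∀ m', h₁ m' < h₂ m') := by
  obtain ⟨g₇, hg₇, huniq⟩ := eq_gstar_of_memFlow_typed h hγu hrg hS hL' hΛ hθ0 hθ1 hC hc m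
  obtain ⟨g₆, hg₆, hlip⟩ := astar_biLipschitz_of_typedTheorem2 h hγu hrg hS hL' hΛ hθ0 hθ1 hC hc m
  obtain ⟨g₃, b₃, b₃', hg₃, -, -, hex⟩ := continuumCoupling_of_typedTheorem2 h hγu hrg hS hL' hΛ hθ0 hθ1 hC hc m
  refine ⟨min g₇ (min g₆ g₃), lt_min hg₇ (lt_min hg₆ hg₃), fun e e' h₁ h₂ he hee' hle hh₁ hh₂ hf₁ hf₂ => ?_⟩
  have he' : 0 < e' := lt_of_lt_of_le he hee'
  have hle7 : e' ≤ g₇ := hle.trans (min_le_left _ _)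
  have hle6 : e' ≤ g₆ := hle.trans ((min_le_right _ _).trans (min_le_left _ _))
  have hle3 : e' ≤ g₃ := hle.trans ((min_le_right _ _).trans (min_le_right _ _))
  obtain ⟨g₀, hI, hend, -⟩ := hex e he (hee'.trans hle3)
  obtain ⟨g₀', hI', hend', -⟩ := hex e' he' hle3
  have e₁ := huniq e g₀ h₁ he (hee'.trans hle7) hI hend hh₁ hf₁
  have e₂ := huniq e' g₀' h₂ he' hle7 hI' hend' hh₂ hf₂
  obtain ⟨hsand, hstrict⟩ := hlip (fun K => S.cpl ⟨K, m, g₀ K⟩) (fun K => S.cpl ⟨K, m, g₀' K⟩) e e'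
    (fun K => ⟨m, g₀ K, rfl⟩) (fun K => ⟨m, g₀' K, rfl⟩) hI hI' hend hend' hee' hle6
  rw [e₁, e₂]
  exact ⟨hsand, hstrict⟩

end

end Summit.QuantumFields.BalabanUV.Beta.EriceFlowEnclosureB12AsPrintedHistoryContagionShiftFlowEnd
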